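import Summits.BirchSwinnertonDyer.Rank1Residual.F1Sign2.DoorFieldAtTwo
import Summits.BirchSwinnertonDyer.Rank1Residual.F1Sign2.ArchReciprocityAtTwo
import Summits.BirchSwinnertonDyer.BirchSwinnertonDyer.Theorems.ByReductionTypeAtTwoRankOneAtTwoBigImageOddLocalOneDoorParity
import Summits.BirchSwinnertonDyer.BirchSwinnertonDyer.Theorems.TwoAdicConverseFrobeniusParityNonsquareDiscriminant
import HarnessLib

/-!
# Route ByReductionTypeAtTwo, crux `RankOneAtTwoBigImageOddLocal` (stmt-BirchSwinnertonDyer-23715), line `one_door_analytic`: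
# the TRANSPOSITION PARITY of a door and the ARCHIMEDEAN FORCING of a descent door — -desc §28 rows R / R⁺ and AN-14G₂ PROVED

Lead prover seat `bsd-line-fkl-p1` g18 (2026-08-29).  THEOREMS ONLY (standard axioms; no `def`, no named fact, no `sorry`, nothing
conditional).  Helper file `--supports stmt-BirchSwinnertonDyer-23715`; it does not close the crux and BSD is not proved by any of this.

The line `one_door_analytic` (v8.17) reads the crux through ONE door field `K = ℚ(√d)` with `d` one-door-admissible
(`RankOneAtTwoOneDoor.DoorAdmissible W d`: `d < 0` squarefree, `d ≡ 1 (8)`, every `q ∣ d` good, `(d/ℓ) = 1` at the odd bad `ℓ`);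
the door's bookkeeping integer is `t = transpCount W d`, the number of TRANSPOSITION primes `q ∣ d` (`(Δ_min/q) = −1`, i.e.
`Frob_q` a transposition on `W[2]`).  The cell's descent lens (-desc g20, MEMO-desc §28; typed by -ty g14 in
`Rank1Residual/F1Sign2/DoorFieldAtTwo.lean`, p683600; REF1-AUDIT §153 «THEOREM-grade, kernel-cheap PROVER TARGET»; REF2 v45 §4.2
«KNOWN-type, corollary of print») filed two rows about this integer and the analytic lens (-an g5/g7) one support law; all three are
proved here:

* `oddTraceSquareResidueLaw_holds : F1Sign2.EggSymbol.OddTraceSquareResidueLaw` (AN-14G₂, `EggSymbolGenusAtTwo.lean`): an odd good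
  prime `q` with `a_q(W)` odd has `(Δ_W/q) = +1`.  It IS the tree theorem
  `TwoAdicTwistConverse.legendreSym_discr_eq_one_of_odd_frobeniusTrace` (route TwoAdicConverse, «a rootless cubic over `𝔽_q` has a
  square discriminant») read through `W.Δ.num = Δ_min` and `legendreSym q a = J(a | q)`.  Consequences by name:
  `noDescAdmissibleOfNonposDisc_holds` (AN-22D of `ArchReciprocityAtTwo.lean`, hitherto proved only modulo G₂) and
  `admissiblePrincipalGenusLaw_of_tamOddSquareLaw` (AN-14G ⟸ G₁ alone).
* `doorForcesArchimedeanAtTwo_holds : F1Sign2.DoorForcesArchimedeanAtTwo` (DESC-28-R): a DESCENT-admissible `d` (every `q ∣ d`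
  good with `a_q` odd) exists only if `Δ_W > 0` — `ArchReciprocity.Δ_pos_of_descAdmissible` ∘ G₂.
* `doorTranspositionParityAtTwo_holds : F1Sign2.DoorTranspositionParityAtTwo` (DESC-28-R⁺): for EVERY one-door-admissible `d`,
  `t(W,d)` is even iff `Δ_W > 0`.  The content is ALREADY the tree's parity layer of this line (this seat g7,
  `…OneDoorParity.lean`: `transpCount_mod_two_of_doorAdmissible`, `t % 2 = [Δ_W < 0]`, from `(−1)^t = J(Δ_min | |d|)` — every
  `q ∣ d` good, `|d|` squarefree — and AN-22J `ArchReciprocity.jacobiSym_natAbs_eq_of_split`, `J(Δ_min | |d|) = sgn Δ_W`); here it is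
  re-read as the typed row's `Prop`, with the pointwise forms `even_transpCount_of_Δ_pos` / `odd_transpCount_of_Δ_neg` (R is its `t = 0`
  instance: a descent door has `transpCount = 0`, tree `transpCount_eq_zero_of_descAdmissible`).  It makes the binder
  `0 < W.Δ` redundant wherever a door with even `t` is assumed, and says that at `Δ_W < 0` every door has an ODD number of
  transposition primes (the line's «exactly one non-silent place: `∞` at `Δ > 0`, the transposition prime at `Δ < 0`» for minimal doors).

References: Hilbert / Jacobi reciprocity for the symbol `(d, Δ_W)` [cite: Kramer1981, Prop. 3 and Thm. 1];
[cite: KrizLi2019, Lemma 5.1]; [cite: SilvermanAEC2009, V.2.3.1].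
-/

set_option autoImplicit false

noncomputable section

open scoped Classical

set_option linter.dupNamespace false

namespace Summit.BirchSwinnertonDyer.BirchSwinnertonDyer.Theorems.RankOneAtTwoOneDoor

open WeierstrassCurve Literature.NumberTheory.EllipticCurves
  Summit.BirchSwinnertonDyer.Rank1Residual.F1Sign2
  Summit.BirchSwinnertonDyer.Rank1Residual.F1Sign2.EggSymbol
  Summit.BirchSwinnertonDyer.Rank1Residual.F1Sign2.ArchReciprocity
  Summit.BirchSwinnertonDyer.BirchSwinnertonDyer.Theorems.TwoAdicTwistConverse

/-! ## §1 AN-14G₂ `OddTraceSquareResidueLaw` is a tree theorem -/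

/-- **AN-14G₂ PROVED**: an odd prime `q` of good reduction with `a_q(W)` odd has `(Δ_W / q) = +1` (the primes of odd trace split in
`ℚ(√Δ)`: Frobenius is a `3`-cycle on `W[2]`, an even permutation).  Read off
`TwoAdicTwistConverse.legendreSym_discr_eq_one_of_odd_frobeniusTrace`. [cite: SilvermanAEC2009, V.2.3.1] -/
theorem oddTraceSquareResidueLaw_holds : OddTraceSquareResidueLaw := by
  intro W _ _ q hq hq2 hgood hodd
  haveI : Fact q.Prime := ⟨hq⟩
  rw [num_Δ_eq_minimalDiscriminantInt, ← jacobiSym.legendreSym.to_jacobiSym]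
  exact legendreSym_discr_eq_one_of_odd_frobeniusTrace W q hq2 (hgood inferInstance) hodd

/-- **AN-22D unconditional**: no descent-admissible twist parameter exists for a globally minimal `W` with `Δ_W < 0`
(`ArchReciprocity.noDescAdmissibleOfNonposDisc_of` ∘ AN-14G₂). -/
theorem noDescAdmissibleOfNonposDisc_holds : NoDescAdmissibleOfNonposDisc :=
  noDescAdmissibleOfNonposDisc_of oddTraceSquareResidueLaw_holds

/-- **AN-14G from G₁ alone**: the principal-genus law `AdmissiblePrincipalGenusLaw` now needs only `TamOddSquareLaw`
(`EggSymbol.admissiblePrincipalGenusLaw_of` with G₂ discharged). -/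
theorem admissiblePrincipalGenusLaw_of_tamOddSquareLaw (h1 : TamOddSquareLaw) : AdmissiblePrincipalGenusLaw :=
  admissiblePrincipalGenusLaw_of h1 oddTraceSquareResidueLaw_holds

/-! ## §2 DESC-28-R: a descent door forces `Δ_W > 0` -/

/-- **DESC-28-R `DoorForcesArchimedeanAtTwo` PROVED**: if `d` is descent-admissible for the globally minimal elliptic `W`
then `0 < Δ_W` (`ArchReciprocity.Δ_pos_of_descAdmissible` ∘ AN-14G₂).  Hence the `Δ_W < 0` half of the residue has no descent
door and the binder `0 < W.Δ` next to `DescAdmissible W d` is redundant. [cite: Kramer1981, Prop. 3 and Thm. 1] -/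
theorem doorForcesArchimedeanAtTwo_holds : DoorForcesArchimedeanAtTwo := by
  intro W _ _ d hadm
  exact Δ_pos_of_descAdmissible oddTraceSquareResidueLaw_holds W hadm

/-! ## §3 DESC-28-R⁺: the parity of the transposition count (by name, from the g7 parity layer) -/

/-- **DESC-28-R⁺ `DoorTranspositionParityAtTwo` PROVED**: for every globally minimal elliptic `W/ℚ` and every one-door-admissible
`d`, the number `t(W,d)` of transposition primes dividing `d` is EVEN iff `Δ_W > 0` — Hilbert/Jacobi reciprocity for `(d, Δ_W)`:
`(d,Δ)_2 = 1` (`d ≡ 1 (8)`), `(d,Δ)_ℓ = 1` at the odd bad `ℓ` (split), `(d,Δ)_q = (Δ_W/q)` at `q ∣ d`, `(d,Δ)_∞ = (−1)^{[Δ_W < 0]}`.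
This is the row's `Prop` read off the tree's parity layer `transpCount_mod_two_of_doorAdmissible` (`t % 2 = [Δ_W < 0]`, this seat g7,
`…OneDoorParity.lean`, itself `neg_one_pow_transpCount_eq_jacobiSym` + AN-22J `ArchReciprocity.jacobiSym_natAbs_eq_of_split`).
[cite: Kramer1981, Prop. 3 and Thm. 1] [cite: KrizLi2019, Lemma 5.1] -/
theorem doorTranspositionParityAtTwo_holds : DoorTranspositionParityAtTwo := by
  intro W _ _ d hadm
  have h := transpCount_mod_two_of_doorAdmissible W hadm
  have hΔ0 : W.Δ ≠ 0 := W.isUnit_Δ.ne_zero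
  rw [Nat.even_iff, h]
  by_cases hneg : W.Δ < 0
  · rw [if_pos hneg]
    exact ⟨fun h10 => absurd h10 (by norm_num), fun hpos => absurd hpos (not_lt.mpr hneg.le)⟩
  · rw [if_neg hneg]
    exact ⟨fun _ => lt_of_le_of_ne (not_lt.mp hneg) hΔ0.symm, fun _ => rfl⟩

/-- Pointwise form of DESC-28-R⁺ for users: at `Δ_W > 0` every door has an EVEN number of transposition primes … -/
theorem even_transpCount_of_Δ_pos (W : WeierstrassCurve ℚ) [W.IsElliptic] [W.IsGloballyMinimal] {d : ℤ}
    (hadm : DoorAdmissible W d) (hΔ : 0 < W.Δ) : Even (transpCount W d) :=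
  (doorTranspositionParityAtTwo_holds W d hadm).mpr hΔ

/-- … and at `Δ_W < 0` an ODD number (so at least one: cf. `ArchReciprocity.exists_transpositionPrime_of_Δ_neg`; for a MINIMAL door,
`t + 2s = [Δ_W < 0]`, exactly one). -/
theorem odd_transpCount_of_Δ_neg (W : WeierstrassCurve ℚ) [W.IsElliptic] [W.IsGloballyMinimal] {d : ℤ}
    (hadm : DoorAdmissible W d) (hΔ : W.Δ < 0) : Odd (transpCount W d) := by
  rw [← Nat.not_even_iff_odd]
  intro heven
  exact absurd ((doorTranspositionParityAtTwo_holds W d hadm).mp heven) (not_lt.mpr hΔ.le)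

end Summit.BirchSwinnertonDyer.BirchSwinnertonDyer.Theorems.RankOneAtTwoOneDoor

end
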